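import Mathlib.Analysis.InnerProductSpace.Laplacian
import Mathlib.Analysis.Calculus.LocalExtr.Basic
import Literature.Analysis.FluidPDE.TsaiMaximumPrinciple
import Literature.Analysis.FluidPDE.KNSSLemma21Proof
import Literature.Analysis.PDE.ParabolicMaximumPrinciple1D
import HarnessLib

/-!
# Crux `MixingPayoff` (stmt-NavierStokesRegularity-1422), line `birth`, stub W2
  (`stub_advectionDiffusionSchwartz`): uniqueness of bounded classical solutions of linear
  second-order parabolic equations on the whole space

Helper file (lands `--supports stmt-NavierStokesRegularity-1422`). For the linear equation

  `∂ₜw = Δw + Dw[β] + γ w`   on `(s, T'] × E`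

(`E` a finite-dimensional real inner product space) with merely BOUNDED coefficients
`‖β‖ ≤ B`, `γ ≤ G`, a bounded function `w`, continuous on `[s, T'] × E`, with `C²` slices and a
left time derivative satisfying the equation on `(s, T']`, and with `w(s, ·) ≤ 0`, is `≤ 0` on
`[s, T'] × E` (`nonpos_of_linear_parabolic`); hence bounded classical solutions are determined
by their initial slice (`eq_zero_of_linear_parabolic`, `eq_of_linear_parabolic`). This is the
weak maximum principle for the Cauchy problem in the class of bounded solutions (Friedman 1964,
Ch. 2, §4, Thm. 10 for solutions with `|u| ≤ M e^{k|x|²}`; here the elementary bounded case):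
the function `z = e^{-λ(t-s)} w − ε(‖x − x⋆‖² + K(t − s))`, `λ = |G| + 1`,
`K = 2 dim E + B² + 1`, is `≤ 0` at `t = s` and on `‖x − x⋆‖ = ρ` for `ερ² ≥ sup |w|`, and at
an interior positive maximum the first/second order conditions contradict the equation;
letting `ε → 0` at `x⋆` gives `w(t, x⋆) ≤ 0`.
-/

noncomputable section

open Set Function Filter Metric Real
open _root_.Topology
open scoped InnerProductSpace

-- `Summit = Problem` for this summit; the tree lakefile sets `weak.linter.dupNamespace = false`.
set_option linter.dupNamespace false

namespace Summit.NavierStokesRegularity.NavierStokesRegularity.Theorems.SelfMixingDichotomy.MixingPayoffBirth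

open Laplacian
open Literature.Analysis.FluidPDE (laplacian_nonpos_of_isLocalMax laplacian_norm_sub_sq)
open Literature.Analysis.PDE (nonneg_of_hasDerivWithinAt_Iic_of_le)

variable {E : Type*} [NormedAddCommGroup E] [InnerProductSpace ℝ E] [FiniteDimensional ℝ E]

set_option maxHeartbeats 800000 in
/-- **Weak maximum principle for the Cauchy problem, bounded solutions** (Friedman 1964, Ch. 2
§4 Thm. 10, elementary bounded case). Let `‖β‖ ≤ B` and `γ ≤ G` on `[s, T'] × E`, and let `w`
be bounded, continuous on `[s, T'] × E`, with `C²` slices on `(s, T']` and, at every point of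
`(s, T'] × E`, a left time derivative equal to `Δw + Dw[β] + γ w`. If `w(s, ·) ≤ 0` then
`w ≤ 0` on `[s, T'] × E`. -/
theorem nonpos_of_linear_parabolic {β : ℝ → E → E} {γ : ℝ → E → ℝ} {w : ℝ → E → ℝ}
    {s T' B G M₀ : ℝ} (hβ : ∀ t ∈ Icc s T', ∀ x, ‖β t x‖ ≤ B)
    (hγ : ∀ t ∈ Icc s T', ∀ x, γ t x ≤ G)
    (hc : ContinuousOn (uncurry w) (Icc s T' ×ˢ univ))
    (h2 : ∀ t ∈ Ioc s T', ContDiff ℝ 2 (w t))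
    (ht : ∀ t ∈ Ioc s T', ∀ x, HasDerivWithinAt (fun τ => w τ x)
      ((Δ (w t)) x + fderiv ℝ (w t) x (β t x) + γ t x * w t x) (Iic t) t)
    (hbd : ∀ t ∈ Icc s T', ∀ x, |w t x| ≤ M₀) (h0 : ∀ x, w s x ≤ 0) :
    ∀ t ∈ Icc s T', ∀ x, w t x ≤ 0 := by
  intro tS htS xS
  rcases eq_or_lt_of_le htS.1 with h | hstS
  · rw [← h]; exact h0 xS
  have hB0 : 0 ≤ B := (norm_nonneg _).trans (hβ tS htS xS)
  have hM0 : 0 ≤ M₀ := (abs_nonneg _).trans (hbd tS htS xS)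
  set d : ℝ := (Module.finrank ℝ E : ℝ) with hd
  set lam : ℝ := |G| + 1 with hlam
  have hlam0 : 0 < lam := by rw [hlam]; positivity
  set K : ℝ := 2 * d + B ^ 2 + 1 with hK
  have hK0 : 0 < K := by rw [hK]; positivity
  -- it suffices to prove `e^{-λ(tS - s)} w(tS, xS) ≤ ε K (tS - s)` for every `ε > 0`
  suffices key : ∀ ε : ℝ, 0 < ε → Real.exp (-lam * (tS - s)) * w tS xS ≤ ε * (K * (tS - s)) by
    have hle : Real.exp (-lam * (tS - s)) * w tS xS ≤ 0 := by
      refine le_of_forall_pos_le_add fun δ hδ => ?_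
      have := key (δ / (K * (tS - s))) (div_pos hδ (mul_pos hK0 (sub_pos.2 hstS)))
      rw [div_mul_cancel₀ _ (mul_pos hK0 (sub_pos.2 hstS)).ne'] at this
      linarith
    by_contra hpos
    push Not at hpos
    have := mul_pos (Real.exp_pos (-lam * (tS - s))) hpos
    linarith
  intro ε hε
  -- the barrier-corrected function
  set ρ : ℝ := Real.sqrt (M₀ / ε) + 1 with hρ
  have hρ0 : 0 < ρ := by rw [hρ]; positivity
  have hρM : M₀ ≤ ε * ρ ^ 2 := by
    have h1 : M₀ / ε ≤ ρ ^ 2 := by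
      have hs := Real.sq_sqrt (div_nonneg hM0 hε.le)
      rw [hρ]; nlinarith [Real.sqrt_nonneg (M₀ / ε)]
    rwa [div_le_iff₀' hε] at h1
  set z : ℝ × E → ℝ := fun p =>
    Real.exp (-lam * (p.1 - s)) * w p.1 p.2 - ε * (‖p.2 - xS‖ ^ 2 + K * (p.1 - s)) with hz
  set Q : Set (ℝ × E) := Icc s tS ×ˢ closedBall xS ρ with hQ
  have hQc : IsCompact Q := isCompact_Icc.prod (isCompact_closedBall xS ρ)
  have hQsub : Q ⊆ Icc s T' ×ˢ univ := prod_mono (Icc_subset_Icc le_rfl htS.2) (subset_univ _)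
  have hzc : ContinuousOn z Q := by
    refine ContinuousOn.sub (ContinuousOn.mul (Continuous.continuousOn (by fun_prop))
      (hc.mono hQsub)) (Continuous.continuousOn (by fun_prop))
  have hXQ : ((tS, xS) : ℝ × E) ∈ Q := ⟨⟨htS.1, le_rfl⟩, mem_closedBall_self hρ0.le⟩
  obtain ⟨Z, hZQ, hZmax⟩ := hQc.exists_isMaxOn ⟨_, hXQ⟩ hzc
  -- ### the maximum of `z` on `Q` is `≤ 0`
  have hzZ : z Z ≤ 0 := by
    by_contra hzpos
    push Not at hzpos
    have hZt : Z.1 ∈ Icc s tS := hZQ.1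
    have hZx : Z.2 ∈ closedBall xS ρ := hZQ.2
    have hZT : Z.1 ∈ Icc s T' := ⟨hZt.1, hZt.2.trans htS.2⟩
    -- not on the bottom
    have hZs : s < Z.1 := by
      rcases eq_or_lt_of_le hZt.1 with h | h
      · exfalso
        have : z Z ≤ 0 := by
          have h1 : z Z = w s Z.2 - ε * ‖Z.2 - xS‖ ^ 2 := by
            simp only [hz, ← h, sub_self, mul_zero, Real.exp_zero, one_mul, add_zero]
          rw [h1]
          nlinarith [h0 Z.2, sq_nonneg ‖Z.2 - xS‖]
        linarith
      · exact h
    have hZI : Z.1 ∈ Ioc s T' := ⟨hZs, hZT.2⟩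
    set e : ℝ := Real.exp (-lam * (Z.1 - s)) with he
    have he0 : 0 < e := Real.exp_pos _
    have he1 : e ≤ 1 := by
      rw [he]; exact Real.exp_le_one_iff.2 (by nlinarith [hZt.1])
    -- not on the lateral boundary
    have hZb : Z.2 ∈ ball xS ρ := by
      by_contra hnot
      have hsph : ‖Z.2 - xS‖ = ρ := by
        have h1 : dist Z.2 xS ≤ ρ := mem_closedBall.1 hZx
        have h2 : ρ ≤ dist Z.2 xS := not_lt.1 fun h => hnot (mem_ball.2 h)
        rw [← dist_eq_norm]; linarith
      have : z Z ≤ 0 := by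
        have h1 : z Z = e * w Z.1 Z.2 - ε * (ρ ^ 2 + K * (Z.1 - s)) := by
          simp only [hz, he, hsph]
        rw [h1]
        have h3 : e * w Z.1 Z.2 ≤ M₀ := by
          have := hbd Z.1 hZT Z.2
          have h4 : e * w Z.1 Z.2 ≤ e * M₀ :=
            mul_le_mul_of_nonneg_left ((le_abs_self _).trans this) he0.le
          nlinarith
        nlinarith [mul_nonneg hε.le (mul_nonneg hK0.le (sub_nonneg.2 hZt.1))]
      linarith
    -- ### the interior analysis at `Z = (t₁, x₁)`
    set t₁ := Z.1 with ht₁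
    set x₁ := Z.2 with hx₁
    have hw2 : ContDiff ℝ 2 (w t₁) := h2 t₁ hZI
    -- the spatial slice of `z` and its derivatives
    set zx : E → ℝ := fun x => e * w t₁ x - ε * (‖x - xS‖ ^ 2 + K * (t₁ - s)) with hzx
    have hzx_eq : ∀ x, z (t₁, x) = zx x := fun x => by simp only [hz, hzx, he]
    have hnsq : ∀ x : E, HasFDerivAt (fun x : E => ‖x - xS‖ ^ 2)
        (2 • (innerSL ℝ (x - xS)).comp (ContinuousLinearMap.id ℝ E)) x :=
      fun x => ((hasFDerivAt_id x).sub_const xS).norm_sq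
    have hzxD : HasFDerivAt zx (e • fderiv ℝ (w t₁) x₁ -
        ε • (2 • (innerSL ℝ (x₁ - xS)).comp (ContinuousLinearMap.id ℝ E))) x₁ := by
      have h1 : HasFDerivAt (fun x => e * w t₁ x) (e • fderiv ℝ (w t₁) x₁) x₁ :=
        ((hw2.differentiable (by norm_num)) x₁).hasFDerivAt.const_mul e
      have h2 : HasFDerivAt (fun x : E => ε * (‖x - xS‖ ^ 2 + K * (t₁ - s)))
          (ε • (2 • (innerSL ℝ (x₁ - xS)).comp (ContinuousLinearMap.id ℝ E))) x₁ := by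
        exact ((hnsq x₁).add_const (K * (t₁ - s))).const_mul ε
      exact h1.sub h2
    have hzx2 : ContDiff ℝ 2 zx :=
      (contDiff_const.mul hw2).sub (contDiff_const.mul
        (((contDiff_id.sub contDiff_const).norm_sq ℝ).add contDiff_const))
    -- `x₁` is a local maximum of the slice
    have hlocmax : IsLocalMax zx x₁ := by
      filter_upwards [isOpen_ball.mem_nhds hZb] with x hx
      rw [← hzx_eq, ← hzx_eq]
      exact hZmax ⟨hZt, ball_subset_closedBall hx⟩
    -- first-order condition
    have hgrad : e • fderiv ℝ (w t₁) x₁ =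
        ε • (2 • (innerSL ℝ (x₁ - xS)).comp (ContinuousLinearMap.id ℝ E)) :=
      sub_eq_zero.1 (hlocmax.hasFDerivAt_eq_zero hzxD)
    have hgradβ : e * fderiv ℝ (w t₁) x₁ (β t₁ x₁) ≤ 2 * ε * (B * ‖x₁ - xS‖) := by
      have h1 := congrArg (fun A : E →L[ℝ] ℝ => A (β t₁ x₁)) hgrad
      simp only [FunLike.coe_smul, Pi.smul_apply, smul_eq_mul,
        innerSL_apply_apply, ContinuousLinearMap.coe_comp, comp_apply, Pi.mul_apply,
        ContinuousLinearMap.coe_id', id_eq, nsmul_eq_mul, Nat.cast_ofNat, Pi.ofNat_apply] at h1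
      rw [h1]
      have h2 : ⟪x₁ - xS, β t₁ x₁⟫_ℝ ≤ ‖x₁ - xS‖ * B :=
        (real_inner_le_norm _ _).trans (mul_le_mul_of_nonneg_left (hβ t₁ hZT x₁) (norm_nonneg _))
      nlinarith
    -- second-order condition
    have hlap : (Δ zx) x₁ ≤ 0 := laplacian_nonpos_of_isLocalMax hzx2 hlocmax
    have hlap_eq : (Δ zx) x₁ = e * (Δ (w t₁)) x₁ - ε * (2 * d) := by
      have hA : ContDiffAt ℝ 2 (fun x => e * w t₁ x) x₁ := (contDiff_const.mul hw2).contDiffAt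
      have hBc : ContDiff ℝ 2 (fun x : E => ε * (‖x - xS‖ ^ 2 + K * (t₁ - s))) :=
        contDiff_const.mul (((contDiff_id.sub contDiff_const).norm_sq ℝ).add contDiff_const)
      rw [show zx = (fun x => e * w t₁ x) - fun x : E => ε * (‖x - xS‖ ^ 2 + K * (t₁ - s)) from rfl,
        hA.laplacian_sub hBc.contDiffAt]
      have h1 : (Δ fun x => e * w t₁ x) x₁ = e * (Δ (w t₁)) x₁ := by
        rw [show (fun x => e * w t₁ x) = e • w t₁ from rfl,
          InnerProductSpace.laplacian_smul e hw2.contDiffAt]; rfl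
      have h2 : (Δ fun x : E => ε * (‖x - xS‖ ^ 2 + K * (t₁ - s))) x₁ = ε * (2 * d) := by
        have hsq : ContDiff ℝ 2 (fun x : E => ‖x - xS‖ ^ 2) :=
          (contDiff_id.sub contDiff_const).norm_sq ℝ
        have hg : ContDiff ℝ 2 (fun x : E => ‖x - xS‖ ^ 2 + K * (t₁ - s)) :=
          hsq.add (contDiff_const (c := K * (t₁ - s)))
        have e1 : (fun x : E => ε * (‖x - xS‖ ^ 2 + K * (t₁ - s))) =
            ε • (fun x : E => ‖x - xS‖ ^ 2 + K * (t₁ - s)) := rfl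
        rw [e1, InnerProductSpace.laplacian_smul ε hg.contDiffAt, smul_eq_mul]
        congr 1
        have e2 : (fun x : E => ‖x - xS‖ ^ 2 + K * (t₁ - s)) =
            (fun x : E => ‖x - xS‖ ^ 2) + fun _ : E => K * (t₁ - s) := rfl
        rw [e2, hsq.contDiffAt.laplacian_add contDiffAt_const, laplacian_norm_sub_sq]
        have e3 : (Δ fun _ : E => K * (t₁ - s)) x₁ = 0 := by
          rw [InnerProductSpace.laplacian_eq_iteratedFDeriv_stdOrthonormalBasis]
          simp [iteratedFDeriv_const_of_ne]
        rw [e3, add_zero]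
      rw [h1, h2]
    -- the left time derivative at a left maximum is nonnegative
    set zt : ℝ → ℝ := fun τ => Real.exp (-lam * (τ - s)) * w τ x₁ -
      ε * (‖x₁ - xS‖ ^ 2 + K * (τ - s)) with hzt
    have hzt_eq : ∀ τ, z (τ, x₁) = zt τ := fun τ => by simp only [hz, hzt]
    have hexpD : HasDerivAt (fun τ : ℝ => Real.exp (-lam * (τ - s))) (-lam * e) t₁ := by
      have h1 : HasDerivAt (fun τ : ℝ => -lam * (τ - s)) (-lam) t₁ := by
        simpa using ((hasDerivAt_id t₁).sub_const s).const_mul (-lam)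
      have := h1.exp
      rw [he]
      convert this using 1; ring
    have hztD : HasDerivWithinAt zt (-lam * e * w t₁ x₁ +
        e * ((Δ (w t₁)) x₁ + fderiv ℝ (w t₁) x₁ (β t₁ x₁) + γ t₁ x₁ * w t₁ x₁) - ε * K)
        (Iic t₁) t₁ := by
      have h1 := (hexpD.hasDerivWithinAt (s := Iic t₁)).mul (ht t₁ hZI x₁)
      have h2 : HasDerivWithinAt (fun τ : ℝ => ε * (‖x₁ - xS‖ ^ 2 + K * (τ - s))) (ε * K)
          (Iic t₁) t₁ := by
        have := ((((hasDerivAt_id t₁).sub_const s).const_mul K).const_add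
          (‖x₁ - xS‖ ^ 2)).const_mul ε
        simpa using this.hasDerivWithinAt
      refine (h1.sub h2).congr_deriv ?_
      rw [he]
    have hleft : ∀ᶠ τ in 𝓝[<] t₁, zt τ ≤ zt t₁ := by
      filter_upwards [Ioo_mem_nhdsLT hZs] with τ hτ
      rw [← hzt_eq, ← hzt_eq]
      exact hZmax ⟨⟨hτ.1.le, hτ.2.le.trans hZt.2⟩, hZx⟩
    have htime := nonneg_of_hasDerivWithinAt_Iic_of_le hztD hleft
    -- ### the contradiction
    have hzval : z Z = e * w t₁ x₁ - ε * (‖x₁ - xS‖ ^ 2 + K * (t₁ - s)) := by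
      simp only [hz, he, ht₁, hx₁]
    have hew : ε * (‖x₁ - xS‖ ^ 2 + K * (t₁ - s)) < e * w t₁ x₁ := by linarith
    have hwpos : 0 < w t₁ x₁ := by
      by_contra hn; push Not at hn
      have : e * w t₁ x₁ ≤ 0 := mul_nonpos_of_nonneg_of_nonpos he0.le hn
      nlinarith [sq_nonneg ‖x₁ - xS‖, mul_nonneg hK0.le (sub_nonneg.2 hZt.1)]
    have hγl : γ t₁ x₁ - lam ≤ -1 := by
      have := hγ t₁ hZT x₁; rw [hlam]; linarith [le_abs_self G]
    have hpot : e * ((γ t₁ x₁ - lam) * w t₁ x₁) ≤ -(ε * ‖x₁ - xS‖ ^ 2) := by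
      have h1 : (γ t₁ x₁ - lam) * w t₁ x₁ ≤ -w t₁ x₁ := by nlinarith
      have h2 : e * ((γ t₁ x₁ - lam) * w t₁ x₁) ≤ -(e * w t₁ x₁) := by nlinarith
      nlinarith [mul_nonneg hε.le (mul_nonneg hK0.le (sub_nonneg.2 hZt.1))]
    have hΔ : e * (Δ (w t₁)) x₁ ≤ ε * (2 * d) := by linarith
    -- combine: `εK ≤ 2εd + 2εB r − ε r²`
    have hmain : ε * K ≤ ε * (2 * d) + 2 * ε * (B * ‖x₁ - xS‖) - ε * ‖x₁ - xS‖ ^ 2 := by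
      nlinarith
    have hr : 2 * (B * ‖x₁ - xS‖) - ‖x₁ - xS‖ ^ 2 ≤ B ^ 2 := by
      nlinarith [sq_nonneg (‖x₁ - xS‖ - B)]
    have : K ≤ 2 * d + B ^ 2 := by
      have h1 : ε * K ≤ ε * (2 * d + B ^ 2) := by nlinarith
      exact le_of_mul_le_mul_left h1 hε
    rw [hK] at this
    linarith
  -- ### conclusion at `(tS, xS)`
  have h1 : z (tS, xS) ≤ z Z := hZmax hXQ
  have h2 : z (tS, xS) = Real.exp (-lam * (tS - s)) * w tS xS - ε * (K * (tS - s)) := by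
    simp only [hz, sub_self, norm_zero]; ring
  linarith

/-- **Uniqueness of bounded classical solutions** of `∂ₜw = Δw + Dw[β] + γw` with bounded
coefficients: a bounded solution (continuous on `[s, T'] × E`, `C²` slices and a left time
derivative solving the equation on `(s, T']`) with `w(s, ·) = 0` vanishes on `[s, T'] × E`
(the maximum principle `nonpos_of_linear_parabolic` applied to `w` and `-w`). -/
theorem eq_zero_of_linear_parabolic {β : ℝ → E → E} {γ : ℝ → E → ℝ} {w : ℝ → E → ℝ}
    {s T' B G M₀ : ℝ} (hβ : ∀ t ∈ Icc s T', ∀ x, ‖β t x‖ ≤ B)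
    (hγ : ∀ t ∈ Icc s T', ∀ x, |γ t x| ≤ G)
    (hc : ContinuousOn (uncurry w) (Icc s T' ×ˢ univ))
    (h2 : ∀ t ∈ Ioc s T', ContDiff ℝ 2 (w t))
    (ht : ∀ t ∈ Ioc s T', ∀ x, HasDerivWithinAt (fun τ => w τ x)
      ((Δ (w t)) x + fderiv ℝ (w t) x (β t x) + γ t x * w t x) (Iic t) t)
    (hbd : ∀ t ∈ Icc s T', ∀ x, |w t x| ≤ M₀) (h0 : ∀ x, w s x = 0) :
    ∀ t ∈ Icc s T', ∀ x, w t x = 0 := by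
  have hγ' : ∀ t ∈ Icc s T', ∀ x, γ t x ≤ G := fun t ht' x => (le_abs_self _).trans (hγ t ht' x)
  have hup := nonpos_of_linear_parabolic hβ hγ' hc h2 ht hbd (fun x => (h0 x).le)
  -- the same for `-w`
  have hc' : ContinuousOn (uncurry fun t x => -w t x) (Icc s T' ×ˢ univ) := hc.neg
  have h2' : ∀ t ∈ Ioc s T', ContDiff ℝ 2 (fun x => -w t x) := fun t ht' => (h2 t ht').neg
  have ht' : ∀ t ∈ Ioc s T', ∀ x, HasDerivWithinAt (fun τ => -w τ x)
      ((Δ (fun x => -w t x)) x + fderiv ℝ (fun x => -w t x) x (β t x) + γ t x * (-w t x))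
      (Iic t) t := by
    intro t htI x
    have h := (ht t htI x).neg
    have hfun : (fun τ => -w τ x) = -fun τ => w τ x := rfl
    rw [hfun]
    refine h.congr_deriv ?_
    rw [show (fun x => -w t x) = -w t from rfl, InnerProductSpace.laplacian_neg, fderiv_neg]
    simp only [Pi.neg_apply, neg_apply]
    ring
  have hbd' : ∀ t ∈ Icc s T', ∀ x, |(-w t x)| ≤ M₀ := fun t ht'' x => by
    rw [abs_neg]; exact hbd t ht'' x
  have hdown := nonpos_of_linear_parabolic hβ hγ' hc' h2' ht' hbd' (fun x => by simp [h0 x])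
  intro t htI x
  exact le_antisymm (hup t htI x) (by have := hdown t htI x; linarith)

/-- Anchor (registered sub-stub of stub W2): `eq_zero_of_linear_parabolic` on `ℝ³` in closed
form. -/
theorem w2aux_uniqueBounded : ∀ (β : ℝ → EuclideanSpace ℝ (Fin 3) → EuclideanSpace ℝ (Fin 3))
    (γ w : ℝ → EuclideanSpace ℝ (Fin 3) → ℝ) (s T' B G M₀ : ℝ),
    (∀ t ∈ Icc s T', ∀ x, ‖β t x‖ ≤ B) → (∀ t ∈ Icc s T', ∀ x, |γ t x| ≤ G) →
    ContinuousOn (uncurry w) (Icc s T' ×ˢ univ) → (∀ t ∈ Ioc s T', ContDiff ℝ 2 (w t)) →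
    (∀ t ∈ Ioc s T', ∀ x, HasDerivWithinAt (fun τ => w τ x)
      ((Δ (w t)) x + fderiv ℝ (w t) x (β t x) + γ t x * w t x) (Iic t) t) →
    (∀ t ∈ Icc s T', ∀ x, |w t x| ≤ M₀) → (∀ x, w s x = 0) →
    ∀ t ∈ Icc s T', ∀ x, w t x = 0 :=
  fun _ _ _ _ _ _ _ _ hβ hγ hc h2 ht hbd h0 => eq_zero_of_linear_parabolic hβ hγ hc h2 ht hbd h0

end Summit.NavierStokesRegularity.NavierStokesRegularity.Theorems.SelfMixingDichotomy.MixingPayoffBirth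

end
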